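import Literature.NumberTheory.Transcendental.PiTranscendenceMeasureCore
import Literature.NumberTheory.Transcendental.PiTranscendenceMeasureParams
import Literature.NumberTheory.Transcendental.PiAlgebraicApproximationMeasure
import Literature.NumberTheory.LFunctions.SchoenfeldPsiSmall
import Literature.NumberTheory.LFunctions.ChebyshevSylvesterPsi
import HarnessLib

/-!
# Transcendence measure for `π` (Nesterenko–Waldschmidt 1996, Theorem 2) — the approximation
# measure for `π`, Theorem 2 (1)′ and the discharge `NesterenkoWaldschmidt1996_thm_2_2_holds`

Sibling PROOFS file of `PiTranscendenceMeasure.lean` (the named fact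
`Literature.NumberTheory.Transcendental.NesterenkoWaldschmidt1996_thm_2_2`: Yu. V. Nesterenko,
M. Waldschmidt, *On the approximation of the values of exponential function and logarithm by
algebraic numbers*, Mat. Zapiski 2 (1996) 23–42 = arXiv:math/0002047, Theorem 2 (2):
`|P(π)| > exp{−2·10⁶ d (log L + d log d)(1 + log d)}`). Everything here is PROVED; no definitions,
no named facts.

The printed proof (p. 2): Theorem 2 (2) follows from Theorem 2 (1) (`|π − ξ| ≥ exp{−1.2·10⁶ d
(log L + d log d)(1 + log d)}` for algebraic `ξ`) by Lemma 1 (Fel'dman's transference; in the tree: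
`NesterenkoWaldschmidt1996_thm_2_2_of_part1`, `PiTranscendenceMeasureProofs.lean`), and Theorem 2 (1)
follows from the Main Theorem (Theorem 1) at `θ = iπ`, `α = e^θ = -1`, `β = iξ`, `E = e²`.
The Main Theorem in this situation is `NWPi.pi_core` (`PiTranscendenceMeasureCore.lean`, §6 a)–d)
with Fel'dman's polynomials of `FeldmanDeltaPolynomials.lean`) with the parameters of
`PiTranscendenceMeasureParams.lean`; this file supplies the last ingredients and assembles:

* `NWPi.log_lcmUpto_le` — the prime number bound `log ν(H) = ψ(H) ≤ 1.15 H` ((4.2) with `107/103`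
  in print), from the tree's `SchoenfeldBound.psi_le_of_le_ten_thousand` (`ψ(x) ≤ 1.04x`, `x ≤ 10⁴`)
  and `psi_le_sylvester` (`ψ(x) ≤ 1.0722x + 7√x`), via `Chebyshev.psi_eq_log_lcmUpto`;
* `NWPi.approx_measure_pi` — **the Main Theorem for `π`**: for `β ≠ 0` algebraic with minimal
  polynomial `Q_β` (irreducible over `ℚ`) of degree `D` and `log M(Q_β) ≤ D h_B`,
  `|β − πi| ≥ exp(−47 D (3.3 D log(D+2) + 2)(2e²π + 2)(h_B + 4 log D + 13.3))`
  (smallness `S 4.2^S |β − πi| e^{2L} ≤ 1` from `params_L`, `|β| ≤ |β − πi| + π ≤ 4.2`);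
* `NWPi.numerics_part1_pi`, `NWPi.part1_pi` — **Theorem 2 (1)** with the constant `1.2·10⁶` for all
  complex algebraic `ξ`: `β = iξ`, `Q_β` from `exists_irreducible_int_aeval_eq_zero`,
  `D = [ℚ(iξ):ℚ] ≤ [ℚ(-1, iξ):ℚ] ≤ 2d` (`finrank_adjoin_eq_natDegree`, `finrank_adjoin_neg_one_I_mul_le`),
  `log M(Q_β) = D h(iξ) ≤ D log M(Q)/d ≤ D (log L)/d` (`weilHeight₁_root_eq`, `weilHeight₁_I_mul_le`,
  `mahlerMeasure_map_le_length`), and `47 D u v w ≤ 1.2·10⁶ d (log L + d log d)(1 + log d)`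
  (cases `d = 1, 2` and `log d ≥ log 3 ≥ 12/11` for `d ≥ 3`);
* `NesterenkoWaldschmidt1996_thm_2_2_holds` — the named fact.

## References

* [NesterenkoWaldschmidt1996] Yu. V. Nesterenko, M. Waldschmidt, Mat. Zapiski 2 (1996) 23–42
  (arXiv:math/0002047), Theorems 1, 2, Lemma 1, §4 (4.2), §6.
-/

noncomputable section

open Polynomial Finset
open scoped Nat

namespace Literature.NumberTheory.Transcendental

namespace NWPi

open FeldmanDelta NW1996 Complex NesterenkoWaldschmidt1996
open Literature.NumberTheory.LFunctions RoyWaldschmidt1997.MahlerWeil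

/-! ### The prime number bound `log ν(H) ≤ 1.15 H` -/

/-- **`log lcm(1, …, H) = ψ(H) ≤ 1.15 H`** for every `H`, from the tree's explicit bounds
`ψ(x) ≤ 1.04 x` (`x ≤ 10⁴`, `SchoenfeldBound.psi_le_of_le_ten_thousand`) and
`ψ(x) ≤ 1.0722 x + 7 √x` (`psi_le_sylvester`). (The printed proof uses `log ν(k) ≤ (107/103) k` of
Rosser–Schoenfeld, (4.2).) [cite: NesterenkoWaldschmidt1996, §4 (4.2)] -/
theorem log_lcmUpto_le (H : ℕ) : Real.log (Nat.lcmUpto H) ≤ 23 / 20 * (H : ℝ) := by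
  rw [← Chebyshev.psi_eq_log_lcmUpto]
  have hH0 : (0 : ℝ) ≤ H := Nat.cast_nonneg _
  by_cases h : (H : ℝ) ≤ 10000
  · have := SchoenfeldBound.psi_le_of_le_ten_thousand hH0 h
    linarith
  · push Not at h
    have h1 := psi_le_sylvester hH0
    have h2 : Real.sqrt H ≤ (H : ℝ) / 100 := by
      rw [Real.sqrt_le_left (by positivity)]
      nlinarith
    linarith

/-! ### The approximation measure for `π` -/

/-- **The approximation measure for `π`** ([NesterenkoWaldschmidt1996, Theorem 1 at `θ = πi`,
`α = -1`, `E = e²`], with the parameters of `PiTranscendenceMeasureParams`): if `β ≠ 0` is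
algebraic with minimal polynomial `Q_β ∈ ℤ[X]` (irreducible over `ℚ`) of degree `D` and
`log M(Q_β) ≤ D h_B` (`h_B ≥ 0`), then
`|β − πi| ≥ exp(−47 D (3.3 D log(D+2) + 2)(2e²π + 2)(h_B + 4 log D + 13.3))`.
[cite: NesterenkoWaldschmidt1996, Theorem 1 and §6] -/
theorem approx_measure_pi {β : ℂ} (hβ0 : β ≠ 0) {Qβ : ℤ[X]}
    (hQβ : Irreducible (Qβ.map (Int.castRingHom ℚ))) (hβQ : aeval β Qβ = 0) {hB : ℝ} (hhB : 0 ≤ hB)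
    (hM : Real.log (Qβ.map (Int.castRingHom ℂ)).mahlerMeasure ≤ Qβ.natDegree * hB) :
    Real.exp (-(47 * (Qβ.natDegree : ℝ) *
        (33 / 10 * Qβ.natDegree * Real.log ((Qβ.natDegree : ℝ) + 2) + 2) *
        (2 * Real.exp 2 * Real.pi + 2) * (hB + 4 * Real.log (Qβ.natDegree : ℝ) + 13.3))) ≤
      ‖β - (Real.pi : ℂ) * I‖ := by
  by_contra hlt
  push Not at hlt
  set D : ℕ := Qβ.natDegree with hD
  have hQ0 : Qβ ≠ 0 := by intro h; apply hQβ.ne_zero; rw [h, Polynomial.map_zero]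
  have hD1 : 1 ≤ D := natDegree_pos_of_aeval_root hQ0 hβQ (fun x hx => by
    rwa [algebraMap_int_eq, eq_intCast, Int.cast_eq_zero] at hx)
  -- parameters
  set u : ℝ := 33 / 10 * (D : ℝ) * Real.log ((D : ℝ) + 2) + 2 with hu
  set v : ℝ := 2 * Real.exp 2 * Real.pi + 2 with hv
  set w : ℝ := hB + 4 * Real.log (D : ℝ) + 13.3 with hw
  set T₁ : ℕ := ⌊2.1 * u + 1 / 2⌋₊ with hT₁
  set S₁ : ℕ := ⌊6 * (D : ℝ) * w + 1 / 2⌋₊ with hS₁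
  set H : ℕ := ⌊1.5 * w⌋₊ with hH
  set S : ℕ := ⌊2.625 * u * v⌋₊ with hS
  set T : ℕ := ⌊5 * (D : ℝ) * v * w⌋₊ with hT
  set L : ℕ := (T + 1) * (2 * T₁ + 1) with hL
  obtain ⟨⟨hH1, hT₁1, hS₁1, hS1⟩, h2T₁, hcount⟩ := params_counts D hD1 hhB hu hv hw hT₁ hS₁ hH hS hT
  obtain ⟨hΦ, -, -, hsmallexp⟩ := params_L D hD1 hhB hu hv hw hT₁ hS₁ hH hS hT hL
  have hmain := params_main D hD1 hhB hu hv hw hT₁ hS₁ hH hS hT hL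
  -- `|β| ≤ 4.2`, `π ≤ 4.2`
  set δ : ℝ := ‖β - (Real.pi : ℂ) * I‖ with hδ
  have hexp47 : δ < Real.exp (-(47 * ((D : ℝ) * u * v * w))) := by
    have e : 47 * ((D : ℝ) * u * v * w) = 47 * (D : ℝ) * u * v * w := by ring
    rw [e]; exact hlt
  have hδ1 : δ ≤ 1 := by
    refine hexp47.le.trans ?_
    rw [Real.exp_le_one_iff]
    have : (0 : ℝ) ≤ 47 * ((D : ℝ) * u * v * w) := by linarith
    linarith
  have hπ := Real.pi_lt_d2
  have hβR : ‖β‖ ≤ 21 / 5 := by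
    have h1 : ‖β‖ ≤ ‖β - (Real.pi : ℂ) * I‖ + ‖(Real.pi : ℂ) * I‖ := norm_le_norm_sub_add _ _
    have h2 : ‖(Real.pi : ℂ) * I‖ = Real.pi := by
      rw [norm_mul, Complex.norm_I, mul_one, Complex.norm_real, Real.norm_eq_abs, abs_of_pos Real.pi_pos]
    rw [h2] at h1
    have : ‖β - (Real.pi : ℂ) * I‖ = δ := rfl
    linarith
  have hπR : Real.pi ≤ 21 / 5 := by linarith
  -- smallness
  have hSpos : (0 : ℝ) < S := by exact_mod_cast hS1
  have hsmall : (S : ℝ) * (21 / 5 : ℝ) ^ S * ‖β - (Real.pi : ℂ) * I‖ * (Real.exp 2) ^ L ≤ 1 := by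
    have e1 : (S : ℝ) * (21 / 5 : ℝ) ^ S * (Real.exp 2) ^ L =
        Real.exp (Real.log S + S * Real.log (21 / 5) + 2 * L) := by
      rw [Real.exp_add, Real.exp_add, Real.exp_log hSpos, Real.exp_nat_mul, Real.exp_log (by norm_num),
        show (2 : ℝ) * L = (L : ℝ) * 2 by ring, Real.exp_nat_mul]
    have e2 : (S : ℝ) * (21 / 5 : ℝ) ^ S * ‖β - (Real.pi : ℂ) * I‖ * (Real.exp 2) ^ L =
        ((S : ℝ) * (21 / 5 : ℝ) ^ S * (Real.exp 2) ^ L) * δ := by rw [hδ]; ring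
    rw [e2, e1]
    have h3 : Real.exp (Real.log S + S * Real.log (21 / 5) + 2 * L) ≤ Real.exp (47 * ((D : ℝ) * u * v * w)) :=
      Real.exp_le_exp.mpr hsmallexp
    have hδ0 : 0 ≤ δ := norm_nonneg _
    calc Real.exp (Real.log S + S * Real.log (21 / 5) + 2 * L) * δ
        ≤ Real.exp (47 * ((D : ℝ) * u * v * w)) * Real.exp (-(47 * ((D : ℝ) * u * v * w))) :=
          mul_le_mul h3 hexp47.le hδ0 (by positivity)
      _ = 1 := by rw [← Real.exp_add, add_neg_cancel, Real.exp_zero]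
  have hE : (1 : ℝ) ≤ Real.exp 2 := Real.one_le_exp (by norm_num)
  exact pi_core hβ0 hQβ hβQ (Dr := (D : ℝ)) le_rfl hM hH1 hT₁1 hS₁1 h2T₁ hcount hL hE
    (by norm_num : (1 : ℝ) ≤ 21 / 5) hβR hπR (log_lcmUpto_le H) hsmall hmain

/-! ### From the approximation measure to Theorem 2 (1)′ (constant `1.2 · 10⁶`) -/

/-- `12/11 ≤ log 3`. [folklore] -/
theorem log_three_ge : (12 : ℝ) / 11 ≤ Real.log 3 := by
  have := div_le_log_of_pow_le (x := 3) 12 11 (by norm_num) (by norm_num)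
  norm_num at this ⊢
  exact this

/-- **The numerical comparison for Theorem 2 (1)**: for an integer `d ≥ 1`, reals `A ≥ 1`,
`1 ≤ D ≤ 2d`, `0 ≤ h_B ≤ A/d`, `v ≤ 48.44`:
`47 D (3.3 D log(D+2) + 2) v (h_B + 4 log D + 13.3) ≤ 1.2·10⁶ d (A + d log d)(1 + log d)`.
[cite: NesterenkoWaldschmidt1996, §1, proof of Theorem 2 (1) from Theorem 1] -/
theorem numerics_part1_pi (d : ℕ) (hd : 1 ≤ d) {A D hB v : ℝ} (hA : 1 ≤ A) (hD1 : 1 ≤ D)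
    (hD : D ≤ 2 * d) (hhB0 : 0 ≤ hB) (hhB : hB ≤ A / d) (hv : v ≤ 48.44) :
    47 * D * (33 / 10 * D * Real.log (D + 2) + 2) * v * (hB + 4 * Real.log D + 13.3) ≤
      1200000 * (d : ℝ) * (A + d * Real.log d) * (1 + Real.log d) := by
  have hdr : (1 : ℝ) ≤ d := by exact_mod_cast hd
  have hd0 : (0 : ℝ) < d := by linarith
  set ld : ℝ := Real.log d with hld
  have hld0 : 0 ≤ ld := Real.log_nonneg hdr
  obtain ⟨hl2lo, hl2hi⟩ := log_two_bounds
  -- `u ≤ 13.18 d (1 + ld)`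
  have hlogD2 : Real.log (D + 2) ≤ 0.6932 + ld + 1 / d := by
    have h1 : Real.log (D + 2) ≤ Real.log (2 * ((d : ℝ) + 1)) :=
      Real.log_le_log (by linarith) (by linarith)
    have h2 : Real.log (2 * ((d : ℝ) + 1)) = Real.log 2 + Real.log ((d : ℝ) + 1) :=
      Real.log_mul (by norm_num) (by linarith)
    have h3 : Real.log ((d : ℝ) + 1) ≤ ld + 1 / d := by
      have h4 : Real.log ((d : ℝ) + 1) - ld = Real.log (((d : ℝ) + 1) / d) := by
        rw [Real.log_div (by linarith) hd0.ne']
      have h5 : Real.log (((d : ℝ) + 1) / d) ≤ ((d : ℝ) + 1) / d - 1 :=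
        Real.log_le_sub_one_of_pos (by positivity)
      have h6 : ((d : ℝ) + 1) / d - 1 = 1 / d := by field_simp; ring
      linarith
    linarith
  have hu : 33 / 10 * D * Real.log (D + 2) + 2 ≤ 13.18 * d * (1 + ld) := by
    have hlogD20 : 0 ≤ Real.log (D + 2) := Real.log_nonneg (by linarith)
    have h1 : 33 / 10 * D * Real.log (D + 2) ≤ 33 / 10 * (2 * d) * (0.6932 + ld + 1 / d) :=
      mul_le_mul (by linarith) hlogD2 hlogD20 (by positivity)
    have h2 : 33 / 10 * (2 * (d : ℝ)) * (0.6932 + ld + 1 / d) = 6.6 * d * ld + 4.57512 * d + 6.6 := by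
      field_simp; ring
    nlinarith
  -- `D w ≤ 2A + 8 d ld + 32.146 d`
  have hw : D * (hB + 4 * Real.log D + 13.3) ≤ 2 * A + 8 * d * ld + 32.146 * d := by
    have h1 : D * hB ≤ 2 * A := by
      calc D * hB ≤ (2 * d) * (A / d) := mul_le_mul hD hhB hhB0 (by positivity)
        _ = 2 * A := by field_simp
    have h2 : Real.log D ≤ Real.log 2 + ld := by
      rw [hld, ← Real.log_mul (by norm_num) hd0.ne']
      exact Real.log_le_log (by linarith) hD
    have h3 : D * Real.log D ≤ (2 * d) * (Real.log 2 + ld) :=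
      mul_le_mul hD h2 (Real.log_nonneg hD1) (by positivity)
    nlinarith
  -- combine
  have hw0 : 0 ≤ hB + 4 * Real.log D + 13.3 := by
    have := Real.log_nonneg hD1; linarith
  have hu0 : 0 ≤ 33 / 10 * D * Real.log (D + 2) + 2 := by
    have := Real.log_nonneg (by linarith : (1 : ℝ) ≤ D + 2); positivity
  have hprod : 47 * D * (33 / 10 * D * Real.log (D + 2) + 2) * v * (hB + 4 * Real.log D + 13.3) ≤
      47 * 48.44 * (13.18 * d * (1 + ld)) * (2 * A + 8 * d * ld + 32.146 * d) := by
    have e : 47 * D * (33 / 10 * D * Real.log (D + 2) + 2) * v * (hB + 4 * Real.log D + 13.3) =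
        47 * v * (33 / 10 * D * Real.log (D + 2) + 2) * (D * (hB + 4 * Real.log D + 13.3)) := by ring
    rw [e]
    have h1 : 47 * v ≤ 47 * 48.44 := by linarith
    have h2 : 47 * v * (33 / 10 * D * Real.log (D + 2) + 2) ≤ 47 * 48.44 * (13.18 * d * (1 + ld)) :=
      mul_le_mul h1 hu hu0 (by norm_num)
    exact mul_le_mul h2 hw (by positivity) (by positivity)
  refine hprod.trans ?_
  -- the final polynomial comparison, by cases on `d`
  have hkey : 30007 * (2 * A + 8 * d * ld + 32.146 * d) ≤ 1200000 * (A + d * ld) := by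
    rcases Nat.lt_or_ge d 3 with hlt | hge
    · interval_cases d
      · have hld1 : ld = 0 := by rw [hld]; norm_num
        rw [hld1]; norm_num; linarith
      · have hld2 : 0.6931 ≤ ld := by
          rw [hld, show ((2 : ℕ) : ℝ) = 2 by norm_num]; exact hl2lo.le
        norm_num
        linarith
    · have h3 : (12 : ℝ) / 11 ≤ ld := by
        rw [hld]
        exact log_three_ge.trans (Real.log_le_log (by norm_num) (by exact_mod_cast hge))
      have h4 := mul_le_mul_of_nonneg_left h3 hd0.le
      have hA0 : 0 ≤ A := by linarith
      linarith
  have hfac : 0 ≤ (d : ℝ) * (1 + ld) := by positivity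
  nlinarith [mul_le_mul_of_nonneg_left hkey hfac]

/-- **Nesterenko–Waldschmidt 1996, Theorem 2 (1)** with the constant `1.2·10⁶`, for every complex
algebraic `ξ`: if `Q ∈ ℤ[X]` is irreducible of degree `d ≥ 1`, `Q(ξ) = 0`, `L(Q) ≤ L`, `L ≥ 3`, then
`|π − ξ| ≥ exp(−1.2·10⁶ d (log L + d log d)(1 + log d))`. From `approx_measure_pi` at `β = iξ`
(`Q_β` its minimal polynomial: `deg Q_β = [ℚ(iξ):ℚ] ≤ 2d`, `log M(Q_β) = D h(iξ) ≤ D log M(Q)/d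
≤ D (log L)/d`) and `numerics_part1_pi`. [cite: NesterenkoWaldschmidt1996, Theorem 2 (1)] -/
theorem part1_pi (Q : ℤ[X]) (ξ : ℂ) (L : ℕ) (hQ : Irreducible Q) (hd : 0 < Q.natDegree)
    (hξ : aeval ξ Q = 0) (hlen : (∑ k ∈ Finset.range (Q.natDegree + 1), |Q.coeff k|) ≤ (L : ℤ))
    (hL : 3 ≤ L) :
    Real.exp (-(1200000 * (Q.natDegree : ℝ) * (Real.log L + Q.natDegree * Real.log Q.natDegree) *
        (1 + Real.log Q.natDegree))) ≤ ‖(Real.pi : ℂ) - ξ‖ := by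
  set d : ℕ := Q.natDegree with hdd
  have hd1 : 1 ≤ d := hd
  have hdr : (1 : ℝ) ≤ d := by exact_mod_cast hd1
  have hL3 : (3 : ℝ) ≤ L := by exact_mod_cast hL
  set A : ℝ := Real.log L with hA
  have hA1 : 1 ≤ A := by
    rw [hA]; exact one_le_log_three.trans (Real.log_le_log (by norm_num) hL3)
  have hld0 : 0 ≤ Real.log (d : ℝ) := Real.log_nonneg hdr
  have hexp_le_one : Real.exp (-(1200000 * (d : ℝ) * (A + d * Real.log d) * (1 + Real.log d))) ≤ 1 := by
    rw [Real.exp_le_one_iff]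
    have : 0 ≤ 1200000 * (d : ℝ) * (A + d * Real.log d) * (1 + Real.log d) := by positivity
    linarith
  -- the trivial case `ξ = 0`
  by_cases hξ0 : ξ = 0
  · rw [hξ0, sub_zero, Complex.norm_real, Real.norm_eq_abs, abs_of_pos Real.pi_pos]
    exact hexp_le_one.trans (by have := Real.pi_gt_three; linarith)
  -- `β = iξ` and its minimal polynomial
  set β : ℂ := I * ξ with hβ
  have hβ0 : β ≠ 0 := mul_ne_zero Complex.I_ne_zero hξ0
  have hQ0 : Q ≠ 0 := hQ.ne_zero
  have hξalg : IsAlgebraic ℚ ξ := by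
    refine ⟨Q.map (Int.castRingHom ℚ), (Polynomial.map_ne_zero_iff (Int.castRingHom ℚ).injective_int).mpr
      hQ0, ?_⟩
    rw [← algebraMap_int_eq, aeval_map_algebraMap]; exact hξ
  have hIalg : IsAlgebraic ℚ I := by
    refine ⟨X ^ 2 + C 1, ?_, by simp⟩
    intro h
    have h2 : (X ^ 2 + C 1 : ℚ[X]).degree = 2 := by rw [degree_X_pow_add_C (by norm_num : 0 < 2)]; rfl
    rw [h, degree_zero] at h2; exact absurd h2 (by decide)
  have hβalg : IsAlgebraic ℚ β := by
    rw [hβ]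
    exact isAlgebraic_iff_isIntegral.mpr
      ((isAlgebraic_iff_isIntegral.mp hIalg).mul (isAlgebraic_iff_isIntegral.mp hξalg))
  obtain ⟨Qβ, hQβirr, hQβdeg, hβQ⟩ := exists_irreducible_int_aeval_eq_zero hβalg
  have hprim : Qβ.IsPrimitive := hQβirr.isPrimitive (by omega)
  have hQβirrQ : Irreducible (Qβ.map (Int.castRingHom ℚ)) := by
    rw [← algebraMap_int_eq]
    exact (hprim.irreducible_iff_irreducible_map_fraction_map (K := ℚ)).mp hQβirr
  set D : ℕ := Qβ.natDegree with hDD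
  -- `D ≤ 2d`
  have hD2d : D ≤ 2 * d := by
    have h1 : Module.finrank ℚ (IntermediateField.adjoin ℚ ({β} : Set ℂ)) = D :=
      finrank_adjoin_eq_natDegree hQβirr hQβdeg hβQ
    haveI : FiniteDimensional ℚ (IntermediateField.adjoin ℚ ({-1, I * ξ} : Set ℂ)) := by
      refine IntermediateField.finiteDimensional_adjoin fun x hx => ?_
      simp only [Set.mem_insert_iff, Set.mem_singleton_iff] at hx
      rcases hx with rfl | rfl
      · exact isIntegral_one.neg
      · exact isAlgebraic_iff_isIntegral.mp hβalg
    have h2 : IntermediateField.adjoin ℚ ({β} : Set ℂ) ≤ IntermediateField.adjoin ℚ ({-1, I * ξ} : Set ℂ) :=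
      IntermediateField.adjoin.mono ℚ _ _ (by rw [hβ]; simp)
    have h3 := IntermediateField.finrank_le_of_le_right h2
    rw [h1] at h3
    exact h3.trans (finrank_adjoin_neg_one_I_mul_le hQ hd hξ)
  -- the height bound `log M(Q_β) ≤ D · log M(Q) / d`
  set M : ℝ := (Q.map (Int.castRingHom ℂ)).mahlerMeasure with hM
  have hM1 : 1 ≤ M := one_le_mahlerMeasure_map hQ0
  set hB : ℝ := Real.log M / d with hhB
  have hhB0 : 0 ≤ hB := div_nonneg (Real.log_nonneg hM1) (by positivity)
  have hMβ : Real.log (Qβ.map (Int.castRingHom ℂ)).mahlerMeasure ≤ D * hB := by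
    set F := IntermediateField.adjoin ℚ ({β} : Set ℂ) with hF
    haveI : FiniteDimensional ℚ F :=
      IntermediateField.adjoin.finiteDimensional (isAlgebraic_iff_isIntegral.mp hβalg)
    have hβF : β ∈ F := IntermediateField.mem_adjoin_simple_self ℚ β
    have h1 := weilHeight₁_root_eq Qβ hQβirr hQβdeg hβQ F hβF
    have h2 := weilHeight₁_I_mul_le hQ hd hξ F (by rw [← hβ]; exact hβF)
    have hDpos : (0 : ℝ) < D := by exact_mod_cast hQβdeg
    have h3 : Real.log (Qβ.map (Int.castRingHom ℂ)).mahlerMeasure = D * weilHeight₁ F (fun _ : Unit => β) := by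
      rw [h1, ← hDD]; field_simp
    rw [h3, hhB, hM, hdd]
    exact mul_le_mul_of_nonneg_left (by rw [hβ] at *; exact h2) hDpos.le
  -- the approximation measure
  have happ := approx_measure_pi hβ0 hQβirrQ hβQ hhB0 hMβ
  have hnorm : ‖β - (Real.pi : ℂ) * I‖ = ‖(Real.pi : ℂ) - ξ‖ := by
    rw [hβ, show I * ξ - (Real.pi : ℂ) * I = I * (ξ - Real.pi) by ring, norm_mul, Complex.norm_I, one_mul,
      norm_sub_rev]
  rw [hnorm] at happ
  refine le_trans ?_ happ
  rw [Real.exp_le_exp, neg_le_neg_iff]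
  -- numerics
  have hlenR : (∑ k ∈ Finset.range (Q.natDegree + 1), |(Q.coeff k : ℝ)|) ≤ L := by
    have h : ((∑ k ∈ Finset.range (Q.natDegree + 1), |Q.coeff k| : ℤ) : ℝ) ≤ ((L : ℤ) : ℝ) := by
      exact_mod_cast hlen
    push_cast at h
    simpa [Int.cast_abs] using h
  have hMlog : Real.log M ≤ A := by
    rw [hA, hM]
    refine Real.log_le_log (lt_of_lt_of_le zero_lt_one hM1) ?_
    exact (mahlerMeasure_map_le_length Q).trans hlenR
  have hhBA : hB ≤ A / d := div_le_div_of_nonneg_right hMlog (by positivity)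
  have hD1 : (1 : ℝ) ≤ D := by exact_mod_cast hQβdeg
  have hD2dr : (D : ℝ) ≤ 2 * d := by exact_mod_cast hD2d
  obtain ⟨-, hv2, -⟩ := v_bounds
  exact numerics_part1_pi d hd1 hA1 hD1 hD2dr hhB0 hhBA hv2

end NWPi

/-! ### Discharge of the named fact -/

/-- **Nesterenko–Waldschmidt 1996, Theorem 2 (2)** holds: the named fact
`NesterenkoWaldschmidt1996_thm_2_2` of `PiTranscendenceMeasure.lean` ("if `P ∈ ℤ[x]`, `P ≠ 0`,
`deg P ≤ d`, `L(P) ≤ L`, `L ≥ 3`, then `|P(π)| > exp{−2·10⁶ d (log L + d log d)(1 + log d)}`"),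
by `NesterenkoWaldschmidt1996_thm_2_2_of_part1` (Lemma 1, the transference) applied to
`NWPi.part1_pi` (Theorem 2 (1) with the constant `1.2·10⁶`, from the Main Theorem for `θ = πi`,
`α = −1` proved in `NWPi.approx_measure_pi`). [cite: NesterenkoWaldschmidt1996, Theorem 2 (2)] -/
theorem NesterenkoWaldschmidt1996_thm_2_2_holds : NesterenkoWaldschmidt1996_thm_2_2 :=
  NesterenkoWaldschmidt1996_thm_2_2_of_part1 NWPi.part1_pi

end Literature.NumberTheory.Transcendental

end
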